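import Literature.RepresentationTheory.MoeglinVignerasWaldspurger1987.RankOneThetaLiftTwistRigidity
import Literature.RepresentationTheory.MoeglinVignerasWaldspurger1987.RankOneThetaLiftLinesEquivalent
import Literature.RepresentationTheory.MoeglinVignerasWaldspurger1987.RankOneThetaLiftSeparation
import Literature.NumberTheory.Automorphic.Liu2021.LemD1LocalInjectivity
import HarnessLib

/-!
# Rank-one theta lifts to `U(3)` at a NON-SPLIT place: isomorphic lifts over two skew-hermitian lines have LINE-TRANSPORTED
# EQUAL splittings — [Liu2021, Lem. D.1 (3)] «⇒», non-split case, CONDITIONAL on rows IV-4c1 and IV-4c3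

Topic `RepresentationTheory/MoeglinVignerasWaldspurger1987`; the NON-SPLIT twin of `RankOneThetaLiftSplitPlaceSeparation.lean`
§1, in the same SECTION currency (`ω_s := (MpPsi.toRep (localSchrodinger F 3 T v)).comp s`, `Θ_s(χ)` its `χ`-coinvariants under
the centre).  THEOREMS ONLY: no definition, no named fact, no `sorry`; debt Δ 0.  The rows IV-4c1 `rankOne_theta_lines_disjoint`
(`RankOneThetaLiftLinesDisjoint.lean`) and IV-4c3 `rankOne_theta_twist_rigidity` (`RankOneThetaLiftTwistRigidity.lean`), both
named facts (D-0014), enter as the HYPOTHESES `h1`, `h3`.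

* `rankOne_theta_nonsplit_exists_lineTransportSplitting_eq_of_areIsomorphicRep` — at a non-split `v`, `Θ_{s₁}(χ₁) ≠ 0` and
  `Θ_{s₁}(χ₁) ≅ Θ_{s₂}(χ₂)` for sections over two lines `δ₁, δ₂` give `x` with `δ₂ ⊗ 1 = x xᶜ (δ₁ ⊗ 1)` (IV-4c1) AND
  `lineTransportSplitting x s₁ = s₂` (IV-4c3 on the line `δ₂`, after `RankOneThetaLiftLinesEquivalent`'s transport).

Written for the cell `hodgecm-mathlib`, line a4-liuD3, stub `stub_mu_of_iso_nonsplit` (:190): with the family-level bookkeeping of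
`Liu2021/LemD1Item3AtVOfSeparation.lean` and Kudla's local injectivity (`GelbartRogawski1991/LocalKudlaSplittingInjective.lean`)
this is the `μ`-clause at a non-split place.  HC_CM is proved only modulo the 7 printed citations until rung 0 closes; nothing of
[Liu2021] is asserted here.

## References
* [Liu2021] Y. Liu, Camb. J. Math. 9 (2021) = arXiv:2102.11518 — App. D Lemma D.1 (3) (l. 5233), proof l. 5255 («known when
  `n = 3` by [GR90, Prop. 5.1.4]»).
* [MoeglinVignerasWaldspurger1987] MVW, LNM 1291, Chap. 2 II.1 (A)–(B) (implementers, conjugate sections), Chap. 3 IV.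
-/

noncomputable section

namespace Literature.RepresentationTheory.MoeglinVignerasWaldspurger1987


open NumberField IsDedekindDomain
open scoped Matrix
open _root_.MeasureTheory
open Literature.RepresentationTheory.HeisenbergGroup (MpPsi)
open Literature.NumberTheory.GelbartRogawski1991.UnitaryDualPair.LocalSplitting (iota LocalMp localSchrodinger)
open Literature.NumberTheory.Automorphic (SchwartzBruhat UnitaryGroup.localPi UnitaryGroup.localCenter UnitaryGroup.LocalRing
  UnitaryGroup.localCenter_comm)
open Literature.NumberTheory.Automorphic.UnitaryGroup (LocalRing conjLocal)
open Literature.NumberTheory.Automorphic.Liu2021 (AreIsomorphicRep)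

set_option autoImplicit false

/-- **[Liu2021, Lem. D.1 (3)] «⇒» at a NON-SPLIT place, the splitting half, CONDITIONAL on rows IV-4c1 and IV-4c3**
(hypotheses `h1 : rankOne_theta_lines_disjoint`, `h3 : rankOne_theta_twist_rigidity`, D-0014), READ AT THE TREE'S OBJECTS with
the binders of those facts, for TWO lines: `E_v` a FIELD, splittings `s₁` over `ι_{δ₁}` and `s₂` over `ι_{δ₂}` with `ω_{sᵢ}`
smooth, unitary continuous characters `χ₁, χ₂` of `U(J₁)(F_v)`.  IF `Θ_{s₁}(χ₁) ≠ 0` and `Θ_{s₁}(χ₁) ≅ Θ_{s₂}(χ₂)` THEN there is a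
unit `x ∈ E_vˣ` with `δ₂ ⊗ 1 = x xᶜ (δ₁ ⊗ 1)` (the lines are in ONE class: IV-4c1 through
`rankOne_theta_epsClass_and_char_eq_of_areIsomorphicRep`) such that the line transport of `s₁` along `x` (a splitting over
`ι_{δ₂}`, `RankOneThetaLiftLinesEquivalent`: smooth, `Θ ≅ Θ_{s₁}(χ₁) ≠ 0`) EQUALS `s₂` (IV-4c3 on the line `δ₂`).  The non-split
twin of `rankOne_theta_split_exists_lineTransportSplitting_eq_of_areIsomorphicRep`; it feeds the `μ`-clause of the cell's line
a4-liuD3 (stub :190) through Kudla's local injectivity (`LocalKudlaSplittingInjective`).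
[cite: Liu2021, App. D Lemma D.1 (3) (l. 5233) and proof l. 5255] [cite: MoeglinVignerasWaldspurger1987, Chap. 3 IV.4] -/
theorem rankOne_theta_nonsplit_exists_lineTransportSplitting_eq_of_areIsomorphicRep (h1 : rankOne_theta_lines_disjoint)
    (h3 : rankOne_theta_twist_rigidity)
    (F : Type) [Field F] [NumberField F] (E : Type) [Field E] [NumberField E] [Algebra F E]
    [Algebra.IsQuadraticExtension F E] (c : E ≃ₐ[F] E)
    (δ₁ : E) (hcδ₁ : c δ₁ = -δ₁) (hδ₁ : δ₁ ≠ 0) (d₁ : F) (hd₁ : δ₁ * δ₁ = algebraMap F E d₁)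
    (δ₂ : E) (hcδ₂ : c δ₂ = -δ₂) (hδ₂ : δ₂ ≠ 0) (d₂ : F) (hd₂ : δ₂ * δ₂ = algebraMap F E d₂)
    (T : Matrix (Fin 3) (Fin 3) F) (hT : T.IsSymm) (hTd : IsUnit T.det)
    (J : Matrix (Fin 3) (Fin 3) E) (hJ : J = T.map (algebraMap F E)) (v : HeightOneSpectrum (𝓞 F))
    (hE : IsField (UnitaryGroup.LocalRing E v))
    (s₁ s₂ : UnitaryGroup.localPi E c 3 J v →* LocalMp F 3 T v)
    (hs₁ : ∀ g, MpPsi.proj _ (s₁ g) = iota F E c 3 hcδ₁ hδ₁ hd₁ T hT hJ v g)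
    (hs₂ : ∀ g, MpPsi.proj _ (s₂ g) = iota F E c 3 hcδ₂ hδ₂ hd₂ T hT hJ v g)
    (hsm₁ : Representation.IsSmooth ((MpPsi.toRep (localSchrodinger F 3 T v)).comp s₁))
    (hsm₂ : Representation.IsSmooth ((MpPsi.toRep (localSchrodinger F 3 T v)).comp s₂))
    (J₁ : Matrix (Fin 1) (Fin 1) E) (hJ₁ : J₁ 0 0 ≠ 0) (χ₁ χ₂ : UnitaryGroup.localPi E c 1 J₁ v →* ℂˣ)
    (hχ₁u : ∀ z, ‖((χ₁ z : ℂˣ) : ℂ)‖ = 1) (hχ₁c : Continuous fun z => ((χ₁ z : ℂˣ) : ℂ))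
    (hχ₂u : ∀ z, ‖((χ₂ z : ℂˣ) : ℂ)‖ = 1) (hχ₂c : Continuous fun z => ((χ₂ z : ℂˣ) : ℂ))
    (hnt : Nontrivial (TwistedCoinv.Coinv
      ((show Representation ℂ (UnitaryGroup.localPi E c 1 J₁ v) (SchwartzBruhat (Fin 3 → v.adicCompletion F)) from
        ((MpPsi.toRep (localSchrodinger F 3 T v)).comp s₁).comp (UnitaryGroup.localCenter E c 3 J J₁ hJ₁ v))) χ₁))
    (hiso : AreIsomorphicRep
      (TwistedCoinv.rep
        (ρW := show Representation ℂ (UnitaryGroup.localPi E c 1 J₁ v) (SchwartzBruhat (Fin 3 → v.adicCompletion F)) from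
          ((MpPsi.toRep (localSchrodinger F 3 T v)).comp s₁).comp (UnitaryGroup.localCenter E c 3 J J₁ hJ₁ v))
        χ₁ ((MpPsi.toRep (localSchrodinger F 3 T v)).comp s₁)
        (fun g z => (show Commute g (UnitaryGroup.localCenter E c 3 J J₁ hJ₁ v z) from
          UnitaryGroup.localCenter_comm E c 3 J J₁ hJ₁ v z g).map ((MpPsi.toRep (localSchrodinger F 3 T v)).comp s₁)))
      (TwistedCoinv.rep
        (ρW := show Representation ℂ (UnitaryGroup.localPi E c 1 J₁ v) (SchwartzBruhat (Fin 3 → v.adicCompletion F)) from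
          ((MpPsi.toRep (localSchrodinger F 3 T v)).comp s₂).comp (UnitaryGroup.localCenter E c 3 J J₁ hJ₁ v))
        χ₂ ((MpPsi.toRep (localSchrodinger F 3 T v)).comp s₂)
        (fun g z => (show Commute g (UnitaryGroup.localCenter E c 3 J J₁ hJ₁ v z) from
          UnitaryGroup.localCenter_comm E c 3 J J₁ hJ₁ v z g).map ((MpPsi.toRep (localSchrodinger F 3 T v)).comp s₂)))) :
    ∃ (x : (LocalRing E v)ˣ) (hx : algebraMap E (LocalRing E v) δ₂ =
        (x : LocalRing E v) * conjLocal E c v x * algebraMap E (LocalRing E v) δ₁),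
      lineTransportSplitting E v c 3 hcδ₁ hδ₁ hd₁ hcδ₂ hδ₂ hd₂ x T hT hTd hx s₁ = s₂ := by
  -- the two lines are in one class (row IV-4c1 through `rankOne_theta_epsClass_and_char_eq_of_areIsomorphicRep`)
  obtain ⟨⟨x, hxε⟩, -⟩ := rankOne_theta_epsClass_and_char_eq_of_areIsomorphicRep h1 F E c δ₁ hcδ₁ hδ₁ d₁ hd₁ δ₂ hcδ₂ hδ₂
    d₂ hd₂ T hT hTd J hJ v hE s₁ s₂ hs₁ hs₂ hsm₁ hsm₂ J₁ hJ₁ χ₁ χ₂ hχ₁u hχ₁c hχ₂u hχ₂c hnt hiso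
  have hx : algebraMap E (LocalRing E v) δ₂ = (x : LocalRing E v) * conjLocal E c v x * algebraMap E (LocalRing E v) δ₁ := by
    have h := congrArg Units.val hxε
    rw [Units.val_mul, Units.val_mul, Units.coe_map] at h
    exact h
  refine ⟨x, hx, ?_⟩
  -- row IV-4c3 on the line `δ₂`, for the transported `s₁` and `s₂`
  refine h3 F E c δ₂ hcδ₂ hδ₂ d₂ hd₂ T hT hTd J hJ v hE
    (lineTransportSplitting E v c 3 hcδ₁ hδ₁ hd₁ hcδ₂ hδ₂ hd₂ x T hT hTd hx s₁) s₂
    (proj_lineTransportSplitting E v c 3 hcδ₁ hδ₁ hd₁ hcδ₂ hδ₂ hd₂ x T hT hTd hJ hx s₁ hs₁) hs₂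
    (isSmooth_lineTransportSplitting E v c 3 hcδ₁ hδ₁ hd₁ hcδ₂ hδ₂ hd₂ x T hT hTd hx s₁ hsm₁) hsm₂
    J₁ hJ₁ χ₁ χ₂ hχ₁u hχ₁c hχ₂u hχ₂c
    ((nontrivial_thetaCoinv_iff_lineTransportSplitting E v c 3 hcδ₁ hδ₁ hd₁ hcδ₂ hδ₂ hd₂ T hT hTd x hx s₁ J₁ hJ₁ χ₁).1 hnt) ?_
  exact (areIsomorphicRep_theta_lineTransportSplitting E v c 3 hcδ₁ hδ₁ hd₁ hcδ₂ hδ₂ hd₂ T hT hTd x hx s₁ J₁ hJ₁ χ₁).symm.trans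
    hiso

end Literature.RepresentationTheory.MoeglinVignerasWaldspurger1987

end
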